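import Summits.HodgeConjecture.HodgeConjecture.Theorems.KummerModuliKumFourClosure
import Summits.HodgeConjecture.HodgeConjecture.Theorems.KummerModuliInvolutionParity
import HarnessLib
import HarnessLib.Audit

/-!
# KummerModuliKumFourParityClosure — the `n = 4` Kummer moduli spaces `K_H(v)`: the Hodge conjecture for `K` and all its powers from refereed print + F125X + T1 + Bülles, modulo LEMMA P's cohomological intermediate `hpar` (faithful) or its untwisted generator-level core `hgeo` (+ T2) — no L1 ∕ L2′ (kernel theorems; nothing asserted)

Summit `HodgeConjecture/HodgeConjecture`; seat `vhodge-19149-w3`; sequel of `Theorems/KummerModuliKumFourClosure.lean`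
(closure modulo the involution parity `hP` at `K`) and `Theorems/KummerModuliInvolutionParity.lean` (`hP` from
`hpar` ∕ `hgeo`).  FILING ANCHOR `--supports stmt-HodgeConjecture-19149` (director's instruction); MATHEMATICAL
TARGET = the `K_H(v)` rung `Theorems.HC_KummerSheafModuliSpace` at `n = 4`; NO bearing on Weil sixfolds.
HONEST FRAMING: kernel theorems from NAMED hypotheses (refereed print: Hirzebruch, Floccari 2026, Göttsche–Soergel,
GKLR, Foster, Floccari–Varesco, Fulton, Arapura, Yoshioka = T1, Markman = T2, Bülles; tree theorems Voisin HI∕HR,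
Milne; F125X = PRINT-SYNTHESIS) plus ONE explicit hypothesis (`hpar`, resp. `hgeo`) which is NOT a fact and NOT
proved: "some `ι₀ ∈ Aut K` extends along `j : K ↪ M_H(v)` to `g : M ⟶ M` acting as `(−1)ᵏ` on every `Hᵏ(M(ℂ); ℂ)`"
(LEMMA P (a)(b)(d) for `ι_M ∘ τ`, `ι_M : E ↦ (−1)^* E`: universal property, Yoshioka's `Φ`, normalised Chern
character + Markman Cor. 2 ∕ Rem. 3 — a seat derivation, hodge-lit-oqh-1 g8), resp. "… acting by `(−1)^{deg}` on
the Künneth factors of `ch(ℰ)`" (the untwisted case `c₁(N) = 0` of LEMMA P (a)).  Nothing here asserts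
`HodgeConjecture`, `HC_AV`, `W₆`, `HC_Kum4Type`, `HC_KummerSheafModuliSpace` or the Hodge conjecture for any
`K_H(v)`; this file does not bear on NonsplitSixfoldCells as typed.  No new definition, no new named fact.

## Director's deliverable shape (director-hodge g8, vhodge INBOX 2026-08-27T11:57:39Z (S2))

`hc_kummerSheafModuliSpace_four_of_markmanOnM (hT1 : T1) (hT2 : T2) … : <the n = 4 K_H(v) statement>` — below, with
T1 = `Yoshioka2001_kummerFibre_restrictionImage`, T2 = `Markman2002_kunnethFactors_generate_cohomology_sheafModuli`,
Bülles, T4 = Foster ∕ Floccari–Varesco BY NAME, the refereed `Kum⁴` facts of the hodge-kum4 cell BY NAME (Hirzebruch,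
Floccari 2026, Göttsche–Soergel, GKLR, Fulton; Voisin HI∕HR and Milne as tree theorems), Arapura, F125X, and T3 in
its irreducible geometric form `hgeo` (untwisted) — LEMMA D, the Markman half of LEMMA P, the "differ by `Γ(K)`"
step, A5 at `K`, I(4) at `K` and the domination are THEOREMS of this chain, not hypotheses; T5 = I(4) is DERIVED at
`n = 4`.  Anti-costume probes (scratch `work/AntiCostumeProbes.lean` of the seat, farm-run): `exact?` closes
neither `Theorems.HC_KummerSheafModuliSpace` nor `Theses.SplitImpliesAll.NonsplitSixfoldCells` from any Tᵢ alone
or from all of them together (8∕8 fail; control succeeds).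
-/

noncomputable section

open CategoryTheory MonoidalCategory
open Literature.AlgebraicTopology.SingularHomology
open Literature.AlgebraicGeometry Literature.AlgebraicGeometry.HodgeTheory Literature.AlgebraicGeometry.ModuliOfSheaves
open Literature.AlgebraicGeometry.Hyperkaehler (IsOfGeneralizedKummerType translationRep totalPullback
  Floccari2026_fixedFourfold_kum4Type Foster2024_translationAction_kumType FloccariVaresco2024_autFixingH2H3_equiv_kumType
  GreenKimLazaRobles2022_llvTrivial_isOfHodgeType_kumType GoettscheSoergel1993_chiY_kum4Type
  HassettTschinkel2013_Oguiso2020_fixedPointScheme_translation_kum4Type)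
open Literature.AlgebraicGeometry.Motives (SchemeOver AbelianVariety IsSmoothProjective)

-- `Summit.<Summit>.<Problem>` is the mandated summit-side namespace (CONVENTIONS §2); for the
-- single-conjunct summit `HodgeConjecture` the two coincide, so the duplicate is deliberate.
set_option linter.dupNamespace false

namespace Summit.HodgeConjecture.HodgeConjecture.Theorems.KummerModuliMarkmanOnM

/-- **THE `n = 4` KUMMER-MODULI CLOSURE modulo LEMMA P's COHOMOLOGICAL INTERMEDIATE (faithful form).**  Same as
`hodgeConjectureFor_kumFour_of_involutionParity`, on a presentation `K ≅ f⁻¹(t) ↪ M = M_H(v)` (the clauses of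
`IsKummerSheafModuliSpace 4 A K`, unbundled), with `hP` DERIVED (`involutionParity_four_of_parityOnCohomology`,
T1 only) from `hpar`: some `ι₀ ∈ Aut K` extends along `j = e.hom ≫ fiberι f t` to `g : M ⟶ M` acting as `(−1)ᵏ`
on every `Hᵏ(M(ℂ); ℂ)` — which is what LEMMA P (a)(b)(d) delivers for `ι_M ∘ τ` (normalised Chern character +
Markman 2002 Cor. 2 ∕ Rem. 3; seat derivation, NOT typed).  All other inputs are NAMED facts (refereed print, the
tree theorems Voisin HI∕HR and Milne, and F125X = print-synthesis).  CONDITIONAL; NOT a proof of the Hodge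
conjecture for any `K_H(v)`. [cite: Yoshioka2001AbelianSurfaces, §4.1] [cite: Bulles2020, Thm. 0.1]
[cite: Arapura2006, Lemma 4.2] [cite: Floccari2026, Lemma 4.2 and Prop. 4.6] [cite: Foster2024, Remark 88]
[cite: FloccariVaresco2024, §3] [cite: Markman2002Generators, Rem. 3] -/
theorem hodgeConjectureFor_kumFour_of_parityOnCohomology
    (hA1 : Hirzebruch1969_gSignature_involution_halfDimFixedLocus)
    (hA2 : Floccari2026_fixedFourfold_kum4Type)
    (hGS : GoettscheSoergel1993_chiY_kum4Type)
    (hGK : GreenKimLazaRobles2022_llvTrivial_isOfHodgeType_kumType)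
    (hF : Foster2024_translationAction_kumType) (hFV : FloccariVaresco2024_autFixingH2H3_equiv_kumType)
    (hFu : Fulton1998_cupPairing_transversalPoint)
    (hA42 : Arapura2006_hodgeClasses_algebraic_of_isDominatedByPowers)
    (hY : Yoshioka2001_kummerFibre_restrictionImage) (hB : Bulles2020_sheafModuli_isDominatedByPowers_surface)
    (h125 : HassettTschinkel2013_Oguiso2020_fixedPointScheme_translation_kum4Type)
    {C : ChernCharacterBetti} {A : AbelianVariety ℂ} {p : complexBetti A.X (2 * 2)} {H : complexBetti A.X (2 * 1)}
    {v : (i : ℕ) → complexBetti A.X (2 * i)} {M : SchemeOver ℂ} {E : (A.X ⊗ M).left.Modules}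
    (hM : AbelianSurfaceSheafModuli C A p H v M E) (hMd : IsSmoothProjective (2 * 4 + 4) M)
    {T : AbelianVariety ℂ} {f : M ⟶ T.X} {t : Motives.ComplexPoints T.X} {K : SchemeOver ℂ}
    (e : K ≅ Motives.fiberOver f t) (hK : IsSmoothProjective (2 * 4) K) (hKum : IsOfGeneralizedKummerType 4 K)
    (hpar : ∃ (ι₀ : Aut K) (g : M ⟶ M), ι₀.hom ≫ (e.hom ≫ Motives.fiberι f t) = (e.hom ≫ Motives.fiberι f t) ≫ g ∧
      ∀ (k : ℕ) (u : complexBetti M k), (complexBetti.map g k).hom u = ((-1 : ℂ) ^ k) • u) :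
    HodgeConjectureFor 8 K ∧ ∀ m : ℕ, HodgeConjectureFor ((m + 1) * 8) (K.pow (m + 1)) :=
  hodgeConjectureFor_kumFour_of_involutionParity hA1 hA2 hGS hGK hF hFV hFu hA42 hY hB h125
    ⟨⟨C, p, H, v, M, E, hM, hMd, T, f, t, ⟨e⟩⟩, hK, hKum⟩
    fun ι h2 h3 c hc ↦ involutionParity_four_of_parityOnCohomology hY hM hMd e hK hKum hpar ι h2 h3 c
      fun γ hγ ↦ hc γ hγ

/-- **THE `n = 4` KUMMER-MODULI CLOSURE modulo the generator-level core of LEMMA P (untwisted case).**  As above,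
with `hpar` obtained from `hgeo` — `ι₀` extends to `g` acting by `(−1)^{deg}` on the Künneth factors of `ch(ℰ)`
(the case where the twist `N` of LEMMA P (a) is trivial) — through Markman 2002 Cor. 2 (T2,
`parityOnCohomology_of_parityOnGenerators`).  CONDITIONAL; NOT a proof of the Hodge conjecture for any `K_H(v)`.
[cite: Markman2002Generators, Cor. 2] [cite: Yoshioka2001AbelianSurfaces, §4.1] [cite: Bulles2020, Thm. 0.1]
[cite: Arapura2006, Lemma 4.2] [cite: Floccari2026, Lemma 4.2 and Prop. 4.6] -/
theorem hodgeConjectureFor_kumFour_of_parityOnGenerators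
    (hA1 : Hirzebruch1969_gSignature_involution_halfDimFixedLocus)
    (hA2 : Floccari2026_fixedFourfold_kum4Type)
    (hGS : GoettscheSoergel1993_chiY_kum4Type)
    (hGK : GreenKimLazaRobles2022_llvTrivial_isOfHodgeType_kumType)
    (hF : Foster2024_translationAction_kumType) (hFV : FloccariVaresco2024_autFixingH2H3_equiv_kumType)
    (hFu : Fulton1998_cupPairing_transversalPoint)
    (hA42 : Arapura2006_hodgeClasses_algebraic_of_isDominatedByPowers)
    (hY : Yoshioka2001_kummerFibre_restrictionImage)
    (hMk : Markman2002_kunnethFactors_generate_cohomology_sheafModuli)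
    (hB : Bulles2020_sheafModuli_isDominatedByPowers_surface)
    (h125 : HassettTschinkel2013_Oguiso2020_fixedPointScheme_translation_kum4Type)
    {C : ChernCharacterBetti} {A : AbelianVariety ℂ} {p : complexBetti A.X (2 * 2)} {H : complexBetti A.X (2 * 1)}
    {v : (i : ℕ) → complexBetti A.X (2 * i)} {M : SchemeOver ℂ} {E : (A.X ⊗ M).left.Modules}
    (hM : AbelianSurfaceSheafModuli C A p H v M E) (hMd : IsSmoothProjective (2 * 4 + 4) M)
    {T : AbelianVariety ℂ} {f : M ⟶ T.X} {t : Motives.ComplexPoints T.X} {K : SchemeOver ℂ}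
    (e : K ≅ Motives.fiberOver f t) (hK : IsSmoothProjective (2 * 4) K) (hKum : IsOfGeneralizedKummerType 4 K)
    (μ : HomologicalOrientation ℂ (Motives.ComplexPoints (M ⊗ A.X)) (2 * (2 * 4 + 4 + 2)))
    (ν : HomologicalOrientation ℂ (Motives.ComplexPoints M) (2 * (2 * 4 + 4))) (hμ : μ.HasPoincareDuality)
    (hν : ν.HasPoincareDuality)
    (hgeo : ∃ (ι₀ : Aut K) (g : M ⟶ M), ι₀.hom ≫ (e.hom ≫ Motives.fiberι f t) = (e.hom ≫ Motives.fiberι f t) ≫ g ∧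
      ∀ x ∈ kunnethGenerators C A.X M E μ ν,
        totalPullback ℂ (Motives.AlgPoints.mapContinuous (L := ℂ) g) x =
          Summit.Ventures.HodgeKum4.HilbertKummer.parityOp ℂ (Motives.ComplexPoints M) x) :
    HodgeConjectureFor 8 K ∧ ∀ m : ℕ, HodgeConjectureFor ((m + 1) * 8) (K.pow (m + 1)) :=
  hodgeConjectureFor_kumFour_of_parityOnCohomology hA1 hA2 hGS hGK hF hFV hFu hA42 hY hB h125 hM hMd e hK hKum
    (parityOnCohomology_of_parityOnGenerators hMk hM hMd μ ν hμ hν hgeo)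

/-- **Director's deliverable (S2), `n = 4` first: `HC(K_H(v))` and all powers for every Kummer moduli space of
`Kum⁴`-type presented as `K ≅ f⁻¹(t) ↪ M_H(v)`, from T1 (Yoshioka), T2 (Markman), Bülles, T4 (Foster,
Floccari–Varesco), the refereed `Kum⁴` facts, Arapura, F125X (print-synthesis) and T3 in geometric form `hgeo`
(untwisted case: some `ι₀ ∈ Aut K` extends along `j` to an endomorphism of `M` acting by `(−1)^{deg}` on the Künneth
factors of `ch(ℰ)`).**  Alias of `hodgeConjectureFor_kumFour_of_parityOnGenerators`; the twisted case is
`hodgeConjectureFor_kumFour_of_parityOnCohomology` (hypothesis `hpar`, T2 not needed).  CONDITIONAL on every named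
fact and on `hgeo`; NOT a proof of the Hodge conjecture for any `K_H(v)`; does not bear on NonsplitSixfoldCells as
typed. [cite: Markman2002Generators, Cor. 2] [cite: Yoshioka2001AbelianSurfaces, §4.1 with Thm. 0.2 (2) and Prop. 4.20]
[cite: Bulles2020, Thm. 0.1] [cite: Foster2024, Remark 88] [cite: FloccariVaresco2024, §3] [cite: Arapura2006, Lemma 4.2]
[cite: Floccari2026, Lemma 4.2 and Prop. 4.6] -/
theorem hc_kummerSheafModuliSpace_four_of_markmanOnM
    (hT1 : Yoshioka2001_kummerFibre_restrictionImage)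
    (hT2 : Markman2002_kunnethFactors_generate_cohomology_sheafModuli)
    (hBu : Bulles2020_sheafModuli_isDominatedByPowers_surface)
    (hT4 : Foster2024_translationAction_kumType) (hT4' : FloccariVaresco2024_autFixingH2H3_equiv_kumType)
    (hA1 : Hirzebruch1969_gSignature_involution_halfDimFixedLocus) (hA2 : Floccari2026_fixedFourfold_kum4Type)
    (hGS : GoettscheSoergel1993_chiY_kum4Type) (hGK : GreenKimLazaRobles2022_llvTrivial_isOfHodgeType_kumType)
    (hFu : Fulton1998_cupPairing_transversalPoint) (hA42 : Arapura2006_hodgeClasses_algebraic_of_isDominatedByPowers)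
    (h125 : HassettTschinkel2013_Oguiso2020_fixedPointScheme_translation_kum4Type)
    {C : ChernCharacterBetti} {A : AbelianVariety ℂ} {p : complexBetti A.X (2 * 2)} {H : complexBetti A.X (2 * 1)}
    {v : (i : ℕ) → complexBetti A.X (2 * i)} {M : SchemeOver ℂ} {E : (A.X ⊗ M).left.Modules}
    (hM : AbelianSurfaceSheafModuli C A p H v M E) (hMd : IsSmoothProjective (2 * 4 + 4) M)
    {T : AbelianVariety ℂ} {f : M ⟶ T.X} {t : Motives.ComplexPoints T.X} {K : SchemeOver ℂ}
    (e : K ≅ Motives.fiberOver f t) (hK : IsSmoothProjective (2 * 4) K) (hKum : IsOfGeneralizedKummerType 4 K)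
    (μ : HomologicalOrientation ℂ (Motives.ComplexPoints (M ⊗ A.X)) (2 * (2 * 4 + 4 + 2)))
    (ν : HomologicalOrientation ℂ (Motives.ComplexPoints M) (2 * (2 * 4 + 4))) (hμ : μ.HasPoincareDuality)
    (hν : ν.HasPoincareDuality)
    (hT3 : ∃ (ι₀ : Aut K) (g : M ⟶ M), ι₀.hom ≫ (e.hom ≫ Motives.fiberι f t) = (e.hom ≫ Motives.fiberι f t) ≫ g ∧
      ∀ x ∈ kunnethGenerators C A.X M E μ ν,
        totalPullback ℂ (Motives.AlgPoints.mapContinuous (L := ℂ) g) x =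
          Summit.Ventures.HodgeKum4.HilbertKummer.parityOp ℂ (Motives.ComplexPoints M) x) :
    HodgeConjectureFor 8 K ∧ ∀ m : ℕ, HodgeConjectureFor ((m + 1) * 8) (K.pow (m + 1)) :=
  hodgeConjectureFor_kumFour_of_parityOnGenerators hA1 hA2 hGS hGK hT4 hT4' hFu hA42 hT1 hT2 hBu h125 hM hMd e hK hKum
    μ ν hμ hν hT3

end Summit.HodgeConjecture.HodgeConjecture.Theorems.KummerModuliMarkmanOnM

end
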